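import Summits.ResolutionOfSingularities.ResolutionOfSingularities.Theorems.FrobeniusLadderFInjectiveMacaulayficationFullLastCentreAxisOrder
import Summits.ResolutionOfSingularities.ResolutionOfSingularities.Theorems.FrobeniusLadderFInjectiveMacaulayficationFullLastCentreResidual
import HarnessLib

/-!
# K10f — THE SLACK CALCULUS IS KERNEL-SOUND ON POLYNOMIALS, FOR CENTRES OF ANY DIMENSION: non-positive slacks are preserved by HIGH-ORDER steps
# (`ν_Z ≥ 2(codim Z − 1)`), and from a stage with non-positive slacks ONE blow-up of any permissible coordinate centre yields `ρ′ ≤ 8 + (2(codim Z − 1) − ν_Z)⁺`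
# at a budgeted drop point — so wildness REQUIRES a low-order positive-dimensional centre (the exposure/birth mechanism of `T-disc` §0.23, typed)
# (crux `FInjectiveMacaulayfication` stmt-ResolutionOfSingularities-15315, chain w45a; kernel form of the slack identity/domination of `T-disc` §0.17/§0.24 (a) and K8, in the typed `Stage`
# language; seat res-L1-w45a-lead-1 g16)

[OURS · L1 W4.5a] Support file (`--supports stmt-ResolutionOfSingularities-15315 --as helper`); replaces the role of NO printed item; NOT a statement of any manuscript;
proves nothing of the crux; OURS counted 0. AI-written (AI review is weaker than expert review).

SLACK of an exceptional letter: `τ_n := 2d_n − α_n`. `AllSlackLE S α` := every exceptional letter has `τ_n ≤ 0`. For a blow-up of `Z = V(x, y_n : n ∈ Nor)` in direction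
`L ∈ Nor` the exponent identity (`alpha_transport`, re-proved here as `alpha_general_step`) gives `α′_L + 6 = Σ_{n∈Nor} α_n + ν` and `α′_n = α_n` otherwise, while
`d′_L = (|Nor| − 3) + Σ_{n ∈ Exc ∩ Nor} d_n`; hence the NEW slack is `τ′_L = 2|Nor| − ν + Σ_{n∈Exc∩Nor} τ_n` (point `8 − ρ + Σ`, curve `6 − ν + Σ`, surface `4 − ν + Σ`,
threefold `2 − ν + Σ` — `T-disc` §0.24 (a) verbatim). THEOREMS: ★ `allSlackLE_step` (preservation when `ν ≥ 2|Nor|`), ★★ `ordLE_of_allSlackLE_drop` (from `AllSlackLE S`,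
at the chart origin with the drop-point budget `ord₀ Disc′ ≤ 8 + 2Σ_{Exc′} d′`: some monomial of `N′` has `tdeg + ν ≤ 8 + 2|Nor|`; in particular `ρ′ ≤ 8` for a high-order
step), ★★★ `highOrderChain_cap` (from `Exc = ∅`, along any chain of HIGH-ORDER blow-ups of permissible coordinate centres of any dimension, a budgeted drop point has
`ρ ≤ 8`). Exponent bookkeeping only; no named fact; any field.
-/

-- single-problem summit: the doubled namespace component is forced
set_option linter.dupNamespace false

noncomputable section

open MvPolynomial Finsupp
open Summit.ResolutionOfSingularities.ResolutionOfSingularities.Theorems.FInjectiveMacaulayfication.LastCentreDefs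
open Summit.ResolutionOfSingularities.ResolutionOfSingularities.Theorems.FInjectiveMacaulayfication.LastCentreAxisOrder
open Summit.ResolutionOfSingularities.ResolutionOfSingularities.Theorems.FInjectiveMacaulayfication.LastCentreResidual

namespace Summit.ResolutionOfSingularities.ResolutionOfSingularities.Theorems.FInjectiveMacaulayfication.LastCentreSlack

variable {k : Type} [Field k]

/-- NON-POSITIVE SLACKS: every exceptional letter `n` has `2·d_n ≤ α_n`. [OURS · L1 W4.5a] -/
def AllSlackLE (S : Stage k) (α : Expo) : Prop :=
  ∀ n ∈ S.Exc, 2 * S.d n ≤ (α n : ℤ)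

/-- The residual witness at the chart origin forces `N ≠ 0` upstairs. [plumbing] -/
theorem support_nonempty_of_chart {S S' : Stage k} {Nor : Finset Letter} {L : Letter} {α α' : Expo} {N N' : YPoly k}
    (hch : IsChart S Nor L S') (hN : IsResidual S.Exc S.D α N) (hN' : IsResidual S'.Exc S'.D α' N') : N.support.Nonempty := by
  classical
  by_contra hemp
  rw [Finset.not_nonempty_iff_eq_empty, MvPolynomial.support_eq_empty] at hemp
  have hL' : L ∈ S'.Exc := by rw [hch.2.2.2.1]; exact Finset.mem_insert_self _ _
  obtain ⟨e₀, he₀, -⟩ := hN'.2.2 L hL'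
  have hEQ : chartMap Nor L S.D = X L ^ 6 * S'.D := disc_chart hch
  rw [hN.1, hemp, mul_zero, map_zero, hN'.1, ← mul_assoc, X_pow_eq_monomial, monomial_mul, one_mul] at hEQ
  have := congrArg (coeff (Finsupp.single L 6 + α' + e₀)) hEQ
  rw [coeff_zero, coeff_add_monomial_mul] at this
  exact (MvPolynomial.mem_support_iff.mp he₀) this.symm

/-- ★ THE EXPONENT IDENTITY for a blow-up of any permissible coordinate centre (`L ∈ Nor`): `α′_n = α_n` for `n ≠ L` and `α′_L + 6 = Σ_{n∈Nor} α_n + ν`.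
(Same bookkeeping as K10 `residual_transport`; stated letterwise.) [OURS · L1 W4.5a] -/
theorem alpha_general_step {S S' : Stage k} {Nor : Finset Letter} {L : Letter} {α α' : Expo} {N N' : YPoly k} (hL : L ∈ Nor)
    (hch : IsChart S Nor L S') (hN : IsResidual S.Exc S.D α N) (hN' : IsResidual S'.Exc S'.D α' N')
    {ν : ℕ} (hν₁ : ∃ e ∈ N.support, norDeg Nor e = ν) (hν₂ : ∀ e ∈ N.support, ν ≤ norDeg Nor e) :
    (∀ n, n ≠ L → α' n = α n) ∧ α' L + 6 = norDeg Nor α + ν := by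
  classical
  obtain ⟨hD, hαoff, hNres⟩ := hN
  obtain ⟨hD', hα'off, hN'res⟩ := hN'
  set A : Expo := tau Nor L α with hA
  set B : Expo := Finsupp.single L 6 + α' with hB
  have hEQ : monomial A (1 : k) * chartMap Nor L N = monomial B (1 : k) * N' := by
    have h1 : chartMap Nor L S.D = monomial A 1 * chartMap Nor L N := by rw [hD, map_mul, chartMap_monomial]
    have h2 : X L ^ 6 * S'.D = monomial B 1 * N' := by rw [hD', ← mul_assoc, X_pow_eq_monomial, monomial_mul, one_mul]
    rw [← h1, ← h2, disc_chart hch]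
  have hExc' : S'.Exc = insert L S.Exc := hch.2.2.2.1
  have fromN' : ∀ e₀ ∈ N'.support, A ≤ B + e₀ ∧ ∃ e₁ ∈ N.support, B + e₀ - A = tau Nor L e₁ := by
    intro e₀ he₀
    have hc : coeff (B + e₀) (monomial A (1 : k) * chartMap Nor L N) ≠ 0 := by
      rw [hEQ, coeff_add_monomial_mul]; exact MvPolynomial.mem_support_iff.mp he₀
    obtain ⟨hAle, hc2⟩ := le_and_coeff_of_coeff_monomial_mul hc
    obtain ⟨e₁, he₁, he₁eq⟩ := exists_of_mem_support_chartMap Nor L N _ (MvPolynomial.mem_support_iff.mpr hc2)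
    exact ⟨hAle, e₁, he₁, he₁eq⟩
  have fromN : ∀ e ∈ N.support, B ≤ A + tau Nor L e := by
    intro e he
    have hc : coeff (A + tau Nor L e) (monomial B (1 : k) * N') ≠ 0 := by
      rw [← hEQ, coeff_add_monomial_mul, coeff_tau_chartMap]; exact MvPolynomial.mem_support_iff.mp he
    exact (le_and_coeff_of_coeff_monomial_mul hc).1
  -- letterwise identity B n = A n + [n = L] ν
  have key : ∀ n, B n = A n + if n = L then ν else 0 := by
    intro n
    apply le_antisymm
    · by_cases hnL : n = L
      · subst hnL; rw [if_pos rfl]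
        obtain ⟨e₀, he₀, he₀ν⟩ := hν₁
        have hle := fromN e₀ he₀ n
        simp only [Finsupp.coe_add, Pi.add_apply, tau_apply_self Nor n e₀ hL] at hle
        omega
      · rw [if_neg hnL, add_zero]
        by_cases hn : n ∈ S.Exc
        · obtain ⟨e₁, he₁, he₁n⟩ := hNres n hn
          have hle := fromN e₁ he₁ n
          simp only [Finsupp.coe_add, Pi.add_apply, tau_apply_ne Nor L e₁ hnL, he₁n] at hle
          omega
        · have hn' : n ∉ S'.Exc := by rw [hExc', Finset.mem_insert]; rintro (h | h); exact hnL h; exact hn h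
          have hBn : B n = 0 := by
            simp only [hB, Finsupp.coe_add, Pi.add_apply, Finsupp.single_apply, if_neg (Ne.symm hnL), zero_add]; exact hα'off n hn'
          omega
    · by_cases hn : n ∈ S'.Exc
      · obtain ⟨e₀, he₀, he₀n⟩ := hN'res n hn
        obtain ⟨hAle, e₁, he₁, heq⟩ := fromN' e₀ he₀
        have hcoord : B n + e₀ n = A n + tau Nor L e₁ n := by
          have h1 := congrArg (fun f => f n) heq
          simp only [Finsupp.coe_tsub, Pi.sub_apply, Finsupp.coe_add, Pi.add_apply] at h1
          have h2 : A n ≤ (B + e₀) n := hAle n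
          simp only [Finsupp.coe_add, Pi.add_apply] at h2
          omega
        by_cases hnL : n = L
        · subst hnL; rw [if_pos rfl]
          have h1 : tau Nor n e₁ n = norDeg Nor e₁ := tau_apply_self Nor n e₁ hL
          have h2 : ν ≤ norDeg Nor e₁ := hν₂ e₁ he₁
          omega
        · rw [if_neg hnL, add_zero]
          have h1 : tau Nor L e₁ n = e₁ n := tau_apply_ne Nor L e₁ hnL
          omega
      · have hnL : n ≠ L := by rintro rfl; exact hn (by rw [hExc']; exact Finset.mem_insert_self _ _)
        have hnE : n ∉ S.Exc := fun h => hn (by rw [hExc']; exact Finset.mem_insert_of_mem h)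
        rw [if_neg hnL, add_zero, hA, tau_apply_ne Nor L α hnL, hαoff n hnE]
        exact Nat.zero_le _
  constructor
  · intro n hn
    have := key n
    simp only [hB, hA, Finsupp.coe_add, Pi.add_apply, Finsupp.single_apply, if_neg (Ne.symm hn), if_neg hn, zero_add, add_zero,
      tau_apply_ne Nor L α hn] at this
    exact this
  · have := key L
    rw [if_pos rfl] at this
    simp only [hB, hA, Finsupp.coe_add, Pi.add_apply, Finsupp.single_eq_same, tau_apply_self Nor L α hL] at this
    omega

/-- ★ NON-POSITIVE SLACKS ARE PRESERVED BY HIGH-ORDER STEPS: if `2|Nor| ≤ ν` (point `ρ ≥ 8`, curve `ν ≥ 6`, surface `ν ≥ 4`, threefold `ν ≥ 2`) then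
`AllSlackLE S α → AllSlackLE S′ α′`. [OURS · L1 W4.5a] -/
theorem allSlackLE_step {S S' : Stage k} {Nor : Finset Letter} {L : Letter} {α α' : Expo} {N N' : YPoly k} (hL : L ∈ Nor)
    (hch : IsChart S Nor L S') (hN : IsResidual S.Exc S.D α N) (hN' : IsResidual S'.Exc S'.D α' N')
    {ν : ℕ} (hν₁ : ∃ e ∈ N.support, norDeg Nor e = ν) (hν₂ : ∀ e ∈ N.support, ν ≤ norDeg Nor e)
    (hhigh : 2 * Nor.card ≤ ν) (hS : AllSlackLE S α) : AllSlackLE S' α' := by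
  classical
  obtain ⟨hα'n, hα'L⟩ := alpha_general_step hL hch hN hN' hν₁ hν₂
  have hExc' : S'.Exc = insert L S.Exc := hch.2.2.2.1
  have hdn : ∀ n, n ≠ L → S'.d n = S.d n := hch.2.2.2.2.1
  have hdL : S'.d L = ((Nor.card : ℤ) + 1 - 4) + ∑ n ∈ S.Exc ∩ Nor, S.d n := hch.2.2.2.2.2
  intro n hn
  by_cases hnL : n = L
  · subst hnL
    rw [hdL]
    -- 2Σ_{Exc∩Nor} d ≤ Σ_{Exc∩Nor} α ≤ Σ_{Nor} α = norDeg Nor α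
    have h1 : 2 * ∑ m ∈ S.Exc ∩ Nor, S.d m ≤ ∑ m ∈ S.Exc ∩ Nor, (α m : ℤ) := by
      rw [Finset.mul_sum]; exact Finset.sum_le_sum fun m hm => hS m (Finset.mem_inter.mp hm).1
    have h2 : (∑ m ∈ S.Exc ∩ Nor, (α m : ℤ)) ≤ (norDeg Nor α : ℤ) := by
      rw [norDeg, Nat.cast_sum]
      exact Finset.sum_le_sum_of_subset_of_nonneg Finset.inter_subset_right fun m _ _ => by positivity
    have h3 : ((α' n : ℕ) : ℤ) + 6 = (norDeg Nor α : ℤ) + ν := by exact_mod_cast hα'L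
    have h4 : (2 * Nor.card : ℤ) ≤ ν := by exact_mod_cast hhigh
    linarith
  · rw [hdn n hnL, hα'n n hnL]
    have hn' : n ∈ S.Exc := by
      rw [hExc', Finset.mem_insert] at hn; rcases hn with h | h; exact absurd h hnL; exact h
    exact hS n hn'

/-- ★★ FROM NON-POSITIVE SLACKS, ONE BLOW-UP, DROP-POINT BUDGET ⇒ `ρ′ ≤ 8 + 2|Nor| − ν`: precisely, some monomial `e` of `N′` has `tdeg e + ν ≤ 8 + 2|Nor|`.
For a HIGH-ORDER step (`ν ≥ 2|Nor|`) this is `ρ′ ≤ 8`; in general the excess over 8 is at most the NEW letter's slack `2|Nor| − ν`. [OURS · L1 W4.5a] -/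
theorem exists_light_of_allSlackLE_drop {S S' : Stage k} {Nor : Finset Letter} {L : Letter} {α α' : Expo} {N N' : YPoly k} (hL : L ∈ Nor)
    (hch : IsChart S Nor L S') (hN : IsResidual S.Exc S.D α N) (hN' : IsResidual S'.Exc S'.D α' N')
    {ν : ℕ} (hν₁ : ∃ e ∈ N.support, norDeg Nor e = ν) (hν₂ : ∀ e ∈ N.support, ν ≤ norDeg Nor e)
    (hS : AllSlackLE S α) (hbud : ∃ f ∈ S'.D.support, (tdeg f : ℤ) ≤ 8 + 2 * ∑ n ∈ S'.Exc, S'.d n) :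
    ∃ e ∈ N'.support, (tdeg e : ℤ) + ν ≤ 8 + 2 * Nor.card := by
  classical
  obtain ⟨hα'n, hα'L⟩ := alpha_general_step hL hch hN hN' hν₁ hν₂
  have hExc' : S'.Exc = insert L S.Exc := hch.2.2.2.1
  have hdn : ∀ n, n ≠ L → S'.d n = S.d n := hch.2.2.2.2.1
  have hdL : S'.d L = ((Nor.card : ℤ) + 1 - 4) + ∑ n ∈ S.Exc ∩ Nor, S.d n := hch.2.2.2.2.2
  obtain ⟨f, hf, hfb⟩ := hbud
  have hc : coeff f (monomial α' (1 : k) * N') ≠ 0 := by rw [← hN'.1]; exact MvPolynomial.mem_support_iff.mp hf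
  obtain ⟨hle, hc2⟩ := le_and_coeff_of_coeff_monomial_mul hc
  refine ⟨f - α', MvPolynomial.mem_support_iff.mpr hc2, ?_⟩
  rw [tdeg_tsub hle]
  -- bookkeeping: Σ_{Exc′} d′ = d′_L + Σ_{Exc∖L} d ; |α′| = α′_L + Σ_{n≠L} α_n ; |α| = α_L + Σ_{n≠L} α_n
  have hsum_d : (∑ n ∈ S'.Exc, S'.d n) = S'.d L + ∑ n ∈ S.Exc.erase L, S.d n := by
    have hins : S'.Exc = insert L (S.Exc.erase L) := by
      rw [hExc']; ext n; simp only [Finset.mem_insert, Finset.mem_erase]; tauto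
    rw [hins, Finset.sum_insert (Finset.notMem_erase L S.Exc)]
    congr 1
    exact Finset.sum_congr rfl fun n hn => hdn n (Finset.ne_of_mem_erase hn)
  have hsum_α' : (tdeg α' : ℤ) = (α' L : ℤ) + ∑ n ∈ Finset.univ.erase L, (α n : ℤ) := by
    rw [tdeg, Nat.cast_sum, ← Finset.add_sum_erase Finset.univ _ (Finset.mem_univ L)]
    congr 1
    exact Finset.sum_congr rfl fun n hn => by rw [hα'n n (Finset.ne_of_mem_erase hn)]
  -- slack inequalities summed
  have hs_eraseL : 2 * ∑ n ∈ S.Exc.erase L, S.d n ≤ ∑ n ∈ S.Exc.erase L, (α n : ℤ) := by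
    rw [Finset.mul_sum]; exact Finset.sum_le_sum fun n hn => hS n (Finset.mem_of_mem_erase hn)
  have hs_inter : 2 * ∑ n ∈ S.Exc ∩ Nor, S.d n ≤ ∑ n ∈ S.Exc ∩ Nor, (α n : ℤ) := by
    rw [Finset.mul_sum]; exact Finset.sum_le_sum fun n hn => hS n (Finset.mem_inter.mp hn).1
  have hsub1 : (∑ n ∈ S.Exc.erase L, (α n : ℤ)) ≤ ∑ n ∈ Finset.univ.erase L, (α n : ℤ) :=
    Finset.sum_le_sum_of_subset_of_nonneg (Finset.erase_subset_erase L (Finset.subset_univ _)) fun n _ _ => by positivity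
  have hsub2 : (∑ n ∈ S.Exc ∩ Nor, (α n : ℤ)) ≤ (norDeg Nor α : ℤ) := by
    rw [norDeg, Nat.cast_sum]
    exact Finset.sum_le_sum_of_subset_of_nonneg Finset.inter_subset_right fun n _ _ => by positivity
  have hα'L' : ((α' L : ℕ) : ℤ) + 6 = (norDeg Nor α : ℤ) + ν := by exact_mod_cast hα'L
  have hmono : (tdeg α' : ℤ) ≤ tdeg f := by exact_mod_cast tdeg_mono hle
  rw [hsum_d, hdL] at hfb
  have : ((tdeg f - tdeg α' : ℕ) : ℤ) = (tdeg f : ℤ) - tdeg α' := by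
    rw [Nat.cast_sub (tdeg_mono hle)]
  rw [this]
  nlinarith [hfb, hsum_α', hs_eraseL, hs_inter, hsub1, hsub2, hα'L', hmono]

/-- COROLLARY (high-order step): `ρ′ ≤ 8`. [OURS · L1 W4.5a] -/
theorem ordLE_eight_of_allSlackLE_drop {S S' : Stage k} {Nor : Finset Letter} {L : Letter} {α α' : Expo} {N N' : YPoly k} (hL : L ∈ Nor)
    (hch : IsChart S Nor L S') (hN : IsResidual S.Exc S.D α N) (hN' : IsResidual S'.Exc S'.D α' N')
    {ν : ℕ} (hν₁ : ∃ e ∈ N.support, norDeg Nor e = ν) (hν₂ : ∀ e ∈ N.support, ν ≤ norDeg Nor e) (hhigh : 2 * Nor.card ≤ ν)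
    (hS : AllSlackLE S α) (hbud : ∃ f ∈ S'.D.support, (tdeg f : ℤ) ≤ 8 + 2 * ∑ n ∈ S'.Exc, S'.d n) : OrdLE N' 8 := by
  obtain ⟨e, he, hb⟩ := exists_light_of_allSlackLE_drop hL hch hN hN' hν₁ hν₂ hS hbud
  refine ⟨e, he, ?_⟩
  have : (2 * Nor.card : ℤ) ≤ ν := by exact_mod_cast hhigh
  omega

/-- HIGH-ORDER CHAINS: chains of blow-ups of permissible coordinate centres `Z_j` (any dimension) each of which is HIGH-ORDER for the residual at that stage:
`ν_{Z_j} ≥ 2·|Nor_j| = 2(codim Z_j − 1)`, stated with a residual decomposition and its minimal normal degree at every step. [OURS · L1 W4.5a] -/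
inductive HighOrderReachable (S₀ : Stage k) : Stage k → Prop
  | refl : HighOrderReachable S₀ S₀
  | step {S S' : Stage k} (Nor : Finset Letter) (L : Letter) (α : Expo) (N : YPoly k) (ν : ℕ) :
      HighOrderReachable S₀ S → L ∈ Nor → IsChart S Nor L S' → IsResidual S.Exc S.D α N →
      (∃ e ∈ N.support, norDeg Nor e = ν) → (∀ e ∈ N.support, ν ≤ norDeg Nor e) → 2 * Nor.card ≤ ν →
        HighOrderReachable S₀ S'

/-- Residual decompositions are unique in their exponent part, hence `AllSlackLE` transfers between decompositions of the same stage. [plumbing] -/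
theorem isResidual_alpha_unique {Exc : Finset Letter} {D : YPoly k} {α β : Expo} {N M : YPoly k}
    (h₁ : IsResidual Exc D α N) (h₂ : IsResidual Exc D β M) : α = β := by
  classical
  -- α n = min exponent of n over supp D for n ∈ Exc, 0 otherwise; same for β
  have key : ∀ {α N}, IsResidual Exc D α N → ∀ n, (n ∉ Exc → α n = 0) ∧ (n ∈ Exc → (∀ f ∈ D.support, α n ≤ f n) ∧ ∃ f ∈ D.support, f n = α n) := by
    intro α N h n
    refine ⟨fun hn => h.2.1 n hn, fun hn => ⟨fun f hf => ?_, ?_⟩⟩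
    · have hc : coeff f (monomial α (1 : k) * N) ≠ 0 := by rw [← h.1]; exact MvPolynomial.mem_support_iff.mp hf
      exact (le_and_coeff_of_coeff_monomial_mul hc).1 n
    · obtain ⟨e, he, hen⟩ := h.2.2 n hn
      refine ⟨α + e, ?_, by simp [hen]⟩
      rw [MvPolynomial.mem_support_iff, h.1, coeff_add_monomial_mul]; exact MvPolynomial.mem_support_iff.mp he
  ext n
  obtain ⟨h1off, h1on⟩ := key h₁ n
  obtain ⟨h2off, h2on⟩ := key h₂ n
  by_cases hn : n ∈ Exc
  · obtain ⟨hle1, f1, hf1, hf1n⟩ := h1on hn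
    obtain ⟨hle2, f2, hf2, hf2n⟩ := h2on hn
    have a := hle1 f2 hf2; have b := hle2 f1 hf1
    omega
  · rw [h1off hn, h2off hn]

/-- Along a high-order chain from an exceptional-free stage, every residual decomposition of every stage has non-positive slacks. [OURS · plumbing] -/
theorem allSlackLE_of_highOrderReachable {S₀ S : Stage k} (hExc : S₀.Exc = ∅) (h : HighOrderReachable S₀ S)
    {α : Expo} {N : YPoly k} (hres : IsResidual S.Exc S.D α N) : AllSlackLE S α := by
  induction h generalizing α N with
  | refl => intro n hn; rw [hExc] at hn; exact absurd hn (Finset.notMem_empty n)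
  | @step S S' Nor L α₀ N₀ ν hprev hL hch hres₀ hν₁ hν₂ hhigh ih =>
    exact allSlackLE_step hL hch hres₀ hres hν₁ hν₂ hhigh (ih hres₀)

/-- ★★★ THE HIGH-ORDER CHAIN CAP (typed, centres of any dimension): from a stage WITHOUT exceptional letters, along any chain of HIGH-ORDER blow-ups of permissible
coordinate centres (`ν_Z ≥ 2(codim Z − 1)` at every step), a final blow-up (itself high-order) to a stage with the DROP-POINT BUDGET has `ord₀ N ≤ 8` for every residual
decomposition. So a wild drop point on ANY chain requires a LOW-ORDER centre somewhere (`ρ ≤ 7` at a point, `ν ≤ 5` at a curve, `ν ≤ 3` at a surface, `ν ≤ 1` at a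
threefold): the birth/exposure mechanism of the permissive wild beds, as a kernel statement. [OURS · L1 W4.5a] -/
theorem highOrderChain_cap {S₀ S T : Stage k} {Nor : Finset Letter} {L : Letter} {α αT : Expo} {N NT : YPoly k} {ν : ℕ} (hExc : S₀.Exc = ∅)
    (hreach : HighOrderReachable S₀ S) (hL : L ∈ Nor) (hch : IsChart S Nor L T)
    (hres : IsResidual S.Exc S.D α N) (hν₁ : ∃ e ∈ N.support, norDeg Nor e = ν) (hν₂ : ∀ e ∈ N.support, ν ≤ norDeg Nor e) (hhigh : 2 * Nor.card ≤ ν)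
    (hresT : IsResidual T.Exc T.D αT NT) (hbud : ∃ f ∈ T.D.support, (tdeg f : ℤ) ≤ 8 + 2 * ∑ n ∈ T.Exc, T.d n) : OrdLE NT 8 :=
  ordLE_eight_of_allSlackLE_drop hL hch hres hresT hν₁ hν₂ hhigh (allSlackLE_of_highOrderReachable hExc hreach hres) hbud

end Summit.ResolutionOfSingularities.ResolutionOfSingularities.Theorems.FInjectiveMacaulayfication.LastCentreSlack

end
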